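import Summits.QuantumFields.YangMills.Theorems.ScalingWindowSplitSelfNormalisedSkewnessWitnessPerSite
import Summits.QuantumFields.YangMills.Theorems.ScalingWindowSplitSelfNormalisedSkewnessWitnessCumulants
import Summits.QuantumFields.YangMills.Theorems.ScalingWindowSplitSelfNormalisedSkewnessStubRingSmearingBound
import Summits.QuantumFields.YangMills.Theorems.ScalingWindowSplitSelfNormalisedSkewnessStubRingTraceBound
import Summits.QuantumFields.YangMills.Theorems.ScalingWindowSplitSelfNormalisedSkewnessStubTorusGreenThirdDiff
import Summits.QuantumFields.YangMills.Theorems.ScalingWindowSplitSelfNormalisedSkewnessStubFlatPairSum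
import HarnessLib

/-!
# `SelfNormalisedSkewness` — negative side: the smeared third moment at fixed lattice step

Route `ScalingWindowSplit`, crux `stmt-QuantumFields-18944`, line `Sketch` (negation branch), support for the
lead's `stub_witnessAssembly`.  For pairwise disjointly supported tests `f g h`, the third central moment of the
bare smeared `U(1)` curvature fields on the torus of side `2L+1` (spacing `a`, `a²L = 1`) is the site expansion
`a¹² ΣΣΣ f g h κ₃(F_x,F_y,F_z)` (`WitnessCumulants`); by the per-site formula (`WitnessPerSite`) and the ring
smearing bound (`stub_ringSmearingBound` ∘ `stub_ringTraceBound` ∘ `stub_torusGreenThirdDiff`) it is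
`O(a¹³β⁻³ log L) + O_{f,g,h}(μ_β(G_εᶜ) + ε⁸ + β⁻³ξ)` — coincident sites drop out exactly by disjointness.

References: Lüscher 1999 §3; standard.  No definitions of propositions, no named facts.
-/

noncomputable section

open scoped BigOperators ENNReal InnerProductSpace
open MeasureTheory ProbabilityTheory
open Literature.MathematicalPhysics.QuantumLattice Literature.MathematicalPhysics.QuantumFieldTheory
open Literature.Probability.LatticeModels (TorusSite torusGreen Torus.proj box)

namespace Summit.QuantumFields.YangMills.Theorems.SelfNormalisedSkewness.Negative

local notation "ZdSite" => Literature.Probability.LatticeModels.Site 4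

/-! ### Schwartz box sums and support bookkeeping -/

/-- **Riemann-sum size of a Schwartz function on the box**: `Σ_{x ∈ box} |f(a x)| ≤ C_f a⁻⁴` (`0 < a ≤ 1`).
[folklore] -/
theorem sum_box_abs_schwartz_le (f : SchwartzMap (EuclideanSpace ℝ (Fin 4)) ℝ) :
    ∃ C : ℝ, 0 ≤ C ∧ ∀ (a : ℝ), 0 < a → a ≤ 1 → ∀ (L : ℕ), ∑ x ∈ box 4 L, |f (a • siteToE x)| ≤ C * a⁻¹ ^ 4 := by
  obtain ⟨Cf, hCf0, hCf⟩ := schwartz_abs_le_inv_pow f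
  refine ⟨256 * Cf, by positivity, fun a ha ha1 L => ?_⟩
  calc ∑ x ∈ box 4 L, |f (a • siteToE x)| ≤ ∑ x ∈ box 4 L, Cf * ((1 + ‖a • siteToE x‖) ^ 8)⁻¹ := by
        refine Finset.sum_le_sum fun x _ => (hCf _).trans ?_
        refine mul_le_mul_of_nonneg_left (inv_anti₀ (by positivity) ?_) hCf0
        exact pow_le_pow_right₀ (by simp) (by norm_num)
    _ = Cf * ∑ x ∈ box 4 L, ((1 + ‖a • siteToE x‖) ^ 8)⁻¹ := by rw [Finset.mul_sum]
    _ ≤ Cf * (256 * a⁻¹ ^ 4) := mul_le_mul_of_nonneg_left (sum_box_weight_le ha ha1 L) hCf0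
    _ = 256 * Cf * a⁻¹ ^ 4 := by ring

/-- Disjointly supported tests have vanishing pointwise product. [folklore] -/
theorem mul_eq_zero_of_disjoint_tsupport {f g : SchwartzMap (EuclideanSpace ℝ (Fin 4)) ℝ}
    (h : Disjoint (tsupport f) (tsupport g)) (X : EuclideanSpace ℝ (Fin 4)) : f X * g X = 0 := by
  by_cases hf : f X = 0
  · rw [hf, zero_mul]
  · have hX : X ∈ tsupport f := subset_tsupport _ (Function.mem_support.2 hf)
    rw [image_eq_zero_of_notMem_tsupport (Set.disjoint_left.1 h hX), mul_zero]

/-- Factorisation of a doubly indexed product sum. [folklore] -/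
theorem sum2_mul_factor {ι : Type*} (s : Finset ι) (A B : ι → ℝ) (E : ℝ) :
    ∑ x ∈ s, ∑ y ∈ s, A x * B y * E = (∑ x ∈ s, A x) * (∑ y ∈ s, B y) * E := by
  rw [Finset.sum_mul_sum, Finset.sum_mul]
  refine Finset.sum_congr rfl fun x _ => ?_
  rw [Finset.sum_mul]

/-- Factorisation of a triply indexed product sum. [folklore] -/
theorem sum3_mul_factor {ι : Type*} (s : Finset ι) (A B C : ι → ℝ) (E : ℝ) :
    ∑ x ∈ s, ∑ y ∈ s, ∑ z ∈ s, A x * B y * C z * E =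
      (∑ x ∈ s, A x) * (∑ y ∈ s, B y) * (∑ z ∈ s, C z) * E := by
  rw [Finset.sum_mul_sum, Finset.sum_mul, Finset.sum_mul]
  refine Finset.sum_congr rfl fun x _ => ?_
  rw [Finset.sum_mul, Finset.sum_mul]
  refine Finset.sum_congr rfl fun y _ => ?_
  rw [Finset.mul_sum, Finset.sum_mul]

/-! ### The smeared third moment -/

/-- **The smeared bare third moment at fixed step.**  For pairwise disjointly supported Schwartz tests there
is `K` such that, on the torus of side `2L+1` with spacing `a` (`0 < a ≤ 1`, `a²L = 1`), for `β > 0` and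
admissible `ε` (the smallness conditions of `box_cumulants`), the third central moment of the bare smeared
`U(1)` curvature fields is at most
`K · (a¹³ β⁻³ (1 + log(2L+1)) + μ_β(G_εᶜ) + ε⁸ + β⁻³ ξ)`, `ξ = β·#P·ε⁴ + #P·(ε√β)⁻⁶`. [folklore] -/
theorem smeared_cm3_bound (f g h : SchwartzMap (EuclideanSpace ℝ (Fin 4)) ℝ)
    (hfg : Disjoint (tsupport f) (tsupport g)) (hfh : Disjoint (tsupport f) (tsupport h))
    (hgh : Disjoint (tsupport g) (tsupport h)) :
    ∃ K : ℝ, 0 ≤ K ∧ ∀ (L : ℕ) (a β ε : ℝ), 0 < a → a ≤ 1 → a ^ 2 * (L : ℝ) = 1 → 0 < β → 0 < ε → ε ≤ 1 →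
      ((2 * L + 1 : ℕ) : ℝ) ^ 4 * ε ≤ 2 * Real.pi → 1 ≤ ε * Real.sqrt β →
      β * Fintype.card (Plaquette 4 (2 * L + 1)) * ε ^ 4 ≤ 1 →
      Fintype.card (Plaquette 4 (2 * L + 1)) * (ε * Real.sqrt β)⁻¹ ^ 6 ≤ 1 →
      (stdGaussian (LinearMap.range (plaqCoboundary (2 * L + 1)))).real
          {w | ∃ p, ε * Real.sqrt β ≤ |⟪frameV (2 * L + 1) p, w⟫_ℝ|} ≤ 1 / 2 →
      |∫ U, (smearedLatticeField (actionDensity u1Rep) (box 4 L) a 1 0 f (torusLift (2 * L + 1) U) -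
              ∫ U', smearedLatticeField (actionDensity u1Rep) (box 4 L) a 1 0 f (torusLift (2 * L + 1) U')
                ∂(wilsonMeasure u1Rep β : Measure (GaugeConfig 4 (2 * L + 1) Circle))) *
            (smearedLatticeField (actionDensity u1Rep) (box 4 L) a 1 0 g (torusLift (2 * L + 1) U) -
              ∫ U', smearedLatticeField (actionDensity u1Rep) (box 4 L) a 1 0 g (torusLift (2 * L + 1) U')
                ∂(wilsonMeasure u1Rep β : Measure (GaugeConfig 4 (2 * L + 1) Circle))) *
            (smearedLatticeField (actionDensity u1Rep) (box 4 L) a 1 0 h (torusLift (2 * L + 1) U) -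
              ∫ U', smearedLatticeField (actionDensity u1Rep) (box 4 L) a 1 0 h (torusLift (2 * L + 1) U')
                ∂(wilsonMeasure u1Rep β : Measure (GaugeConfig 4 (2 * L + 1) Circle)))
          ∂(wilsonMeasure u1Rep β : Measure (GaugeConfig 4 (2 * L + 1) Circle))| ≤
        K * (a ^ 13 * β⁻¹ ^ 3 * (1 + Real.log (2 * L + 1)) +
          (wilsonMeasure u1Rep β : Measure (GaugeConfig 4 (2 * L + 1) Circle)).real
            {U : GaugeConfig 4 (2 * L + 1) Circle | ∀ p : Plaquette 4 (2 * L + 1), |plaqAngle U p| < ε}ᶜ +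
          ε ^ 8 + β⁻¹ ^ 3 * (β * Fintype.card (Plaquette 4 (2 * L + 1)) * ε ^ 4 +
            Fintype.card (Plaquette 4 (2 * L + 1)) * (ε * Real.sqrt β)⁻¹ ^ 6)) := by
  obtain ⟨C, hC0, hsite⟩ := site_cumulants
  obtain ⟨CR, hR⟩ := stub_ringSmearingBound (stub_ringTraceBound stub_torusGreenThirdDiff) f g h hfg hfh hgh
  obtain ⟨Cf, hCf0, hCf⟩ := sum_box_abs_schwartz_le f
  obtain ⟨Cg, hCg0, hCg⟩ := sum_box_abs_schwartz_le g
  obtain ⟨Ch, hCh0, hCh⟩ := sum_box_abs_schwartz_le h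
  have hCR0 : 0 ≤ max CR 0 := le_max_right _ _
  refine ⟨max CR 0 + Cf * Cg * Ch * (C + 10 + C), by positivity, ?_⟩
  intro L a β ε ha ha1 haL hβ hε hε1 hSε ht hw hτ htail
  set S : ℕ := 2 * L + 1 with hS
  set μ : Measure (GaugeConfig 4 S Circle) := wilsonMeasure u1Rep β with hμ
  haveI : IsProbabilityMeasure μ := isProbabilityMeasure_wilsonMeasure (L := S) u1Rep continuous_u1Rep β
  set η := μ.real {U : GaugeConfig 4 S Circle | ∀ p : Plaquette 4 S, |plaqAngle U p| < ε}ᶜ with hη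
  set ξ := β * Fintype.card (Plaquette 4 S) * ε ^ 4 + Fintype.card (Plaquette 4 S) * (ε * Real.sqrt β)⁻¹ ^ 6
    with hξ
  have hη0 : 0 ≤ η := measureReal_nonneg
  have hξ0 : 0 ≤ ξ := by positivity
  have hb : 0 ≤ β⁻¹ := inv_nonneg.2 hβ.le
  -- the per-site formula
  have hεπ : ε ≤ Real.pi := hε1.trans (by linarith [Real.pi_gt_three])
  have h6 : 6 * ε ≤ 2 * Real.pi := by linarith [Real.pi_gt_three]
  have site := fun x y z => hsite S β ε hβ hε hε1 hεπ hSε h6 ht hw hτ htail x y z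
  -- site expansion of the smeared third moment
  obtain ⟨CO, hCO⟩ := u1LatticeRep.curvature.bounded
  have hOm : Measurable (actionDensity u1Rep : LGConfig 4 Circle → ℝ) := u1LatticeRep.curvature.measurable
  rw [integral_centered_mul_mul_eq_sum hOm hCO (box 4 L) a f g h μ]
  -- identify the site cumulants
  have hX : ∀ x : ZdSite, (fun U : GaugeConfig 4 S Circle => actionDensity u1Rep (configShift (-x) (torusLift S U))) =
      Fsite (Torus.proj S x) := fun x => funext fun U => actionDensity_u1_site_eq_sum_cos U x
  have hcm : ∀ x y z : ZdSite,
      ∫ U, (actionDensity u1Rep (configShift (-x) (torusLift S U)) -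
            ∫ U', actionDensity u1Rep (configShift (-x) (torusLift S U')) ∂μ) *
          (actionDensity u1Rep (configShift (-y) (torusLift S U)) -
            ∫ U', actionDensity u1Rep (configShift (-y) (torusLift S U')) ∂μ) *
          (actionDensity u1Rep (configShift (-z) (torusLift S U)) -
            ∫ U', actionDensity u1Rep (configShift (-z) (torusLift S U')) ∂μ) ∂μ =
        cm3 μ (Fsite (Torus.proj S x)) (Fsite (Torus.proj S y)) (Fsite (Torus.proj S z)) := by
    intro x y z
    rw [← hX x, ← hX y, ← hX z]
    rfl
  simp_rw [hcm]
  -- split each site cumulant into the ring and the error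
  set ring3 : ZdSite → ZdSite → ZdSite → ℝ := fun x y z => ∑ α, ∑ α', ∑ α'',
    maxwellK S (Torus.proj S x - Torus.proj S y) α α' * maxwellK S (Torus.proj S y - Torus.proj S z) α' α'' *
      maxwellK S (Torus.proj S z - Torus.proj S x) α'' α with hring3
  set E3 : ZdSite → ZdSite → ZdSite → ℝ := fun x y z =>
    cm3 μ (Fsite (Torus.proj S x)) (Fsite (Torus.proj S y)) (Fsite (Torus.proj S z)) + β⁻¹ ^ 3 * ring3 x y z
    with hE3
  have hE3b : ∀ x y z, |E3 x y z| ≤ C * η + 10 * ε ^ 8 + C * β⁻¹ ^ 3 * ξ := fun x y z => (site _ _ _).1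
  have hsplit : ∀ x y z : ZdSite,
      f (a • siteToE x) * g (a • siteToE y) * h (a • siteToE z) *
          cm3 μ (Fsite (Torus.proj S x)) (Fsite (Torus.proj S y)) (Fsite (Torus.proj S z)) =
        -(β⁻¹ ^ 3) * (f (a • siteToE x) * g (a • siteToE y) * h (a • siteToE z) * ring3 x y z) +
          f (a • siteToE x) * g (a • siteToE y) * h (a • siteToE z) * E3 x y z := by
    intro x y z; simp only [hE3]; ring
  simp_rw [hsplit, Finset.sum_add_distrib, ← Finset.mul_sum]
  -- (i) the ring part: coincident sites drop out, then the ring smearing bound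
  have hvan_xy : ∀ x z : ZdSite, f (a • siteToE x) * g (a • siteToE x) * h (a • siteToE z) * ring3 x x z = 0 :=
    fun x z => by rw [mul_eq_zero_of_disjoint_tsupport hfg, zero_mul, zero_mul]
  have hvan_xz : ∀ x y : ZdSite, f (a • siteToE x) * g (a • siteToE y) * h (a • siteToE x) * ring3 x y x = 0 :=
    fun x y => by
    have := mul_eq_zero_of_disjoint_tsupport hfh (a • siteToE x)
    rw [mul_right_comm (f _), this, zero_mul, zero_mul]
  have hvan_yz : ∀ x y : ZdSite, f (a • siteToE x) * g (a • siteToE y) * h (a • siteToE y) * ring3 x y y = 0 :=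
    fun x y => by
    have := mul_eq_zero_of_disjoint_tsupport hgh (a • siteToE y)
    rw [mul_assoc (f _), this, mul_zero, zero_mul]
  have hin : ∀ x y : ZdSite, ∑ z ∈ ((box 4 L).erase x).erase y,
      f (a • siteToE x) * g (a • siteToE y) * h (a • siteToE z) * ring3 x y z =
      ∑ z ∈ box 4 L, f (a • siteToE x) * g (a • siteToE y) * h (a • siteToE z) * ring3 x y z := fun x y => by
    rw [Finset.sum_erase ((box 4 L).erase x) (a := y)
        (f := fun z => f (a • siteToE x) * g (a • siteToE y) * h (a • siteToE z) * ring3 x y z) (hvan_yz x y),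
      Finset.sum_erase (box 4 L) (a := x)
        (f := fun z => f (a • siteToE x) * g (a • siteToE y) * h (a • siteToE z) * ring3 x y z) (hvan_xz x y)]
  have hout : ∀ x : ZdSite, ∑ y ∈ (box 4 L).erase x, ∑ z ∈ box 4 L,
      f (a • siteToE x) * g (a • siteToE y) * h (a • siteToE z) * ring3 x y z =
      ∑ y ∈ box 4 L, ∑ z ∈ box 4 L, f (a • siteToE x) * g (a • siteToE y) * h (a • siteToE z) * ring3 x y z :=
    fun x => Finset.sum_erase (box 4 L) (a := x)
      (f := fun y => ∑ z ∈ box 4 L, f (a • siteToE x) * g (a • siteToE y) * h (a • siteToE z) * ring3 x y z)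
      (Finset.sum_eq_zero fun z _ => hvan_xy x z)
  have hring_eq : ∑ x ∈ box 4 L, ∑ y ∈ box 4 L, ∑ z ∈ box 4 L,
      f (a • siteToE x) * g (a • siteToE y) * h (a • siteToE z) * ring3 x y z =
      ∑ x ∈ box 4 L, ∑ y ∈ (box 4 L).erase x, ∑ z ∈ ((box 4 L).erase x).erase y,
        f (a • siteToE x) * g (a • siteToE y) * h (a • siteToE z) * ring3 x y z := by
    refine Finset.sum_congr rfl fun x _ => ?_
    rw [← hout x]
    exact Finset.sum_congr rfl fun y _ => (hin x y).symm
  have hRing := hR a ha ha1 L haL (maxwellH S) maxwellH_spec (maxwellK S) maxwellK_spec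
  rw [hring_eq]
  -- (ii) the error part
  have herr : |∑ x ∈ box 4 L, ∑ y ∈ box 4 L, ∑ z ∈ box 4 L,
      f (a • siteToE x) * g (a • siteToE y) * h (a • siteToE z) * E3 x y z| ≤
      (Cf * a⁻¹ ^ 4) * (Cg * a⁻¹ ^ 4) * (Ch * a⁻¹ ^ 4) * (C * η + 10 * ε ^ 8 + C * β⁻¹ ^ 3 * ξ) := by
    have herr0 : 0 ≤ C * η + 10 * ε ^ 8 + C * β⁻¹ ^ 3 * ξ := by positivity
    calc |∑ x ∈ box 4 L, ∑ y ∈ box 4 L, ∑ z ∈ box 4 L,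
          f (a • siteToE x) * g (a • siteToE y) * h (a • siteToE z) * E3 x y z|
        ≤ ∑ x ∈ box 4 L, ∑ y ∈ box 4 L, ∑ z ∈ box 4 L,
          |f (a • siteToE x)| * |g (a • siteToE y)| * |h (a • siteToE z)| *
            (C * η + 10 * ε ^ 8 + C * β⁻¹ ^ 3 * ξ) := by
          refine (Finset.abs_sum_le_sum_abs _ _).trans (Finset.sum_le_sum fun x _ => ?_)
          refine (Finset.abs_sum_le_sum_abs _ _).trans (Finset.sum_le_sum fun y _ => ?_)
          refine (Finset.abs_sum_le_sum_abs _ _).trans (Finset.sum_le_sum fun z _ => ?_)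
          rw [abs_mul, abs_mul, abs_mul]
          exact mul_le_mul_of_nonneg_left (hE3b x y z) (by positivity)
      _ = (∑ x ∈ box 4 L, |f (a • siteToE x)|) * (∑ y ∈ box 4 L, |g (a • siteToE y)|) *
            (∑ z ∈ box 4 L, |h (a • siteToE z)|) * (C * η + 10 * ε ^ 8 + C * β⁻¹ ^ 3 * ξ) :=
          sum3_mul_factor (box 4 L) (fun x => |f (a • siteToE x)|) (fun y => |g (a • siteToE y)|)
            (fun z => |h (a • siteToE z)|) _
      _ ≤ (Cf * a⁻¹ ^ 4) * (Cg * a⁻¹ ^ 4) * (Ch * a⁻¹ ^ 4) * (C * η + 10 * ε ^ 8 + C * β⁻¹ ^ 3 * ξ) := by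
          have s0 : ∀ w : SchwartzMap (EuclideanSpace ℝ (Fin 4)) ℝ, 0 ≤ ∑ x ∈ box 4 L, |w (a • siteToE x)| :=
            fun w => Finset.sum_nonneg fun _ _ => abs_nonneg _
          refine mul_le_mul_of_nonneg_right ?_ herr0
          exact mul_le_mul (mul_le_mul (hCf a ha ha1 L) (hCg a ha ha1 L) (s0 g) (by positivity))
            (hCh a ha ha1 L) (s0 h) (by positivity)
  -- combine
  have hlog : 0 ≤ 1 + Real.log (2 * L + 1) := by
    have : (1 : ℝ) ≤ 2 * L + 1 := by have := Nat.cast_nonneg (α := ℝ) L; linarith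
    linarith [Real.log_nonneg this]
  calc |a ^ 12 * (-(β⁻¹ ^ 3) * ∑ x ∈ box 4 L, ∑ y ∈ (box 4 L).erase x, ∑ z ∈ ((box 4 L).erase x).erase y,
          f (a • siteToE x) * g (a • siteToE y) * h (a • siteToE z) * ring3 x y z +
        ∑ x ∈ box 4 L, ∑ y ∈ box 4 L, ∑ z ∈ box 4 L,
          f (a • siteToE x) * g (a • siteToE y) * h (a • siteToE z) * E3 x y z)|
      ≤ a ^ 12 * (β⁻¹ ^ 3 * (CR * a * (1 + Real.log (2 * L + 1))) +
          (Cf * a⁻¹ ^ 4) * (Cg * a⁻¹ ^ 4) * (Ch * a⁻¹ ^ 4) * (C * η + 10 * ε ^ 8 + C * β⁻¹ ^ 3 * ξ)) := by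
        rw [abs_mul, abs_of_pos (by positivity : (0 : ℝ) < a ^ 12)]
        refine mul_le_mul_of_nonneg_left ((abs_add_le _ _).trans (add_le_add ?_ herr)) (by positivity)
        rw [abs_mul, abs_neg, abs_of_nonneg (pow_nonneg hb 3)]
        exact mul_le_mul_of_nonneg_left hRing (pow_nonneg hb 3)
    _ = CR * (a ^ 13 * β⁻¹ ^ 3 * (1 + Real.log (2 * L + 1))) +
          Cf * Cg * Ch * (C * η + 10 * ε ^ 8 + C * β⁻¹ ^ 3 * ξ) := by
        field_simp
    _ ≤ max CR 0 * (a ^ 13 * β⁻¹ ^ 3 * (1 + Real.log (2 * L + 1))) +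
          Cf * Cg * Ch * ((C + 10 + C) * (η + ε ^ 8 + β⁻¹ ^ 3 * ξ)) := by
        have t2 : C * η + 10 * ε ^ 8 + C * β⁻¹ ^ 3 * ξ ≤ (C + 10 + C) * (η + ε ^ 8 + β⁻¹ ^ 3 * ξ) := by
          have e : (C + 10 + C) * (η + ε ^ 8 + β⁻¹ ^ 3 * ξ) - (C * η + 10 * ε ^ 8 + C * β⁻¹ ^ 3 * ξ) =
              (C + 10) * η + (C + C) * ε ^ 8 + (C + 10) * (β⁻¹ ^ 3 * ξ) := by ring
          have hp : 0 ≤ (C + 10) * η + (C + C) * ε ^ 8 + (C + 10) * (β⁻¹ ^ 3 * ξ) := by positivity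
          linarith
        exact add_le_add (mul_le_mul_of_nonneg_right (le_max_left _ _) (by positivity))
          (mul_le_mul_of_nonneg_left t2 (by positivity))
    _ ≤ (max CR 0 + Cf * Cg * Ch * (C + 10 + C)) * (a ^ 13 * β⁻¹ ^ 3 * (1 + Real.log (2 * L + 1)) + η +
          ε ^ 8 + β⁻¹ ^ 3 * ξ) := by
        have e : (max CR 0 + Cf * Cg * Ch * (C + 10 + C)) * (a ^ 13 * β⁻¹ ^ 3 * (1 + Real.log (2 * L + 1)) + η +
            ε ^ 8 + β⁻¹ ^ 3 * ξ) - (max CR 0 * (a ^ 13 * β⁻¹ ^ 3 * (1 + Real.log (2 * L + 1))) +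
            Cf * Cg * Ch * ((C + 10 + C) * (η + ε ^ 8 + β⁻¹ ^ 3 * ξ))) =
            max CR 0 * (η + ε ^ 8 + β⁻¹ ^ 3 * ξ) +
              Cf * Cg * Ch * (C + 10 + C) * (a ^ 13 * β⁻¹ ^ 3 * (1 + Real.log (2 * L + 1))) := by ring
        have hp : 0 ≤ max CR 0 * (η + ε ^ 8 + β⁻¹ ^ 3 * ξ) +
            Cf * Cg * Ch * (C + 10 + C) * (a ^ 13 * β⁻¹ ^ 3 * (1 + Real.log (2 * L + 1))) := by positivity
        linarith

end Summit.QuantumFields.YangMills.Theorems.SelfNormalisedSkewness.Negative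

end
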